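import Summits.AtomisticToContinuum.Crystallization.Theorems.HolmgrenBoyleLindGroundStatesChargeFLCEquilibriumOfPeriodicSupport
import Summits.AtomisticToContinuum.Crystallization.Theses.IsometryAtoms

/-!
# Crux `HolmgrenBoyleLind.GroundStatesChargeFLCEquilibrium` (stmt-AtomisticToContinuum-6076)
# from the cruxes of route `IsometryAtoms` (PURITY 15776, COHESION 15777, BRIDGE 15778)

The law-level content of the crux (the line's single open stub `stub_minimisingLawsChargeFLC`:
every minimising point-stationary hard-core law charges, at every scale, the patches of ONE FLC
Delone set) splits exactly as the sibling route `IsometryAtoms` splits `PeriodicSupport`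
(stmt-AtomisticToContinuum-12747): PURITY (`MinimisingLawsHaveAtoms`, the law has an atom modulo
`E(3)`), COHESION (`MinimisingLawsCohesive`, a.s. relative density) and the BRIDGE
(`AtomicLawChargesCrystal`, an atom of a cohesive point-stationary hard-core law is a periodic
crystal whose windows are charged). Fed pointwise in `(δ, P)`, the three give the statement of
`PeriodicSupport` verbatim, and the landed `groundStatesChargeFLCEquilibrium_of_periodicSupport`
(p146166) turns it into the crux. CONDITIONAL on the three open items of route `IsometryAtoms`;
nothing here closes an item. Remark recorded for the planners: the FLC (rather than periodic)
conclusion of this crux gives no slack on the Palm side either — for an atom `Y` with finitely many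
`Sym(Y)`-orbits, finite local complexity of `Y` is equivalent to finiteness of the point group of
`Sym(Y)`, i.e. to the Bieberbach-type input of the bridge. [folklore]
-/

namespace Summit.AtomisticToContinuum.Crystallization.Theorems.HolmgrenBoyleLindGroundStatesChargeFLCEquilibrium

open Summit.AtomisticToContinuum.Crystallization.Theses

/-- **PURITY + COHESION + BRIDGE (route `IsometryAtoms`, items 15776, 15777, 15778) give
`PeriodicSupport` (item 12747) pointwise in the law.** [folklore] -/
theorem periodicSupport_of_isometryAtoms
    (hAtom : IsometryAtoms.MinimisingLawsHaveAtoms) (hCoh : IsometryAtoms.MinimisingLawsCohesive)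
    (hBridge : IsometryAtoms.AtomicLawChargesCrystal) :
    BenjaminiSchrammPeriodicSupport.PeriodicSupport :=
  fun δ hδ P hP hhc hst hE =>
    hBridge δ hδ P hP hhc hst (hCoh δ hδ P hP hhc hst hE) (hAtom δ hδ P hP hhc hst hE)

/-- **The crux `GroundStatesChargeFLCEquilibrium` from the three cruxes of route `IsometryAtoms`**
(conditional reduction: composition of `periodicSupport_of_isometryAtoms` with the landed
`groundStatesChargeFLCEquilibrium_of_periodicSupport`). [folklore] -/
theorem groundStatesChargeFLCEquilibrium_of_isometryAtoms : Summit.AtomisticToContinuum.Crystallization.Theses.IsometryAtoms.MinimisingLawsHaveAtoms → Summit.AtomisticToContinuum.Crystallization.Theses.IsometryAtoms.MinimisingLawsCohesive → Summit.AtomisticToContinuum.Crystallization.Theses.IsometryAtoms.AtomicLawChargesCrystal → Summit.AtomisticToContinuum.Crystallization.Theses.HolmgrenBoyleLind.GroundStatesChargeFLCEquilibrium :=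
  fun hAtom hCoh hBridge => groundStatesChargeFLCEquilibrium_of_periodicSupport
    (periodicSupport_of_isometryAtoms hAtom hCoh hBridge)

end Summit.AtomisticToContinuum.Crystallization.Theorems.HolmgrenBoyleLindGroundStatesChargeFLCEquilibrium
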